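import Literature.Topology.FourManifolds.ClosedModelHomology
import Literature.Topology.FourManifolds.HomotopySpheresBPOrderSignatureLeavesProofs
import Literature.Topology.FourManifolds.HomotopySpheresSignature
import Literature.Topology.FourManifolds.NullCobordismBoundaryHomology
import Literature.Topology.FourManifolds.BordismFourOrientation
import Literature.AlgebraicTopology.SingularHomology.BoundaryClassGenerator
import Literature.AlgebraicTopology.SingularHomology.CollapseMap
import HarnessLib

/-!
# Orientations of the closed model `W ∪ cone(∂W)` at the cone point, without a manifold structure

(Companion of `ClosedModelConeOrientation.lean` (other unit, cone orientation under `ConnectedSpace W`);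
this file does NOT assume `W` connected and records the converse `IsOrientedBy → IsRelFundamentalClass`.)


Kervaire–Milnor (*Groups of homotopy spheres I*, Ann. of Math. 77 (1963), §7, footnote
pp. 528–529) compute the signature of a compact oriented manifold `W` bounded by a homology
sphere on `Ŵ = W ∪ cone(bW)`, "a closed homology manifold". In the tree the orientation of `W`
is accordingly recorded as a homological orientation `μ'` of the closed model
`Literature.Topology.FourManifolds.ClosedModel n W` together with a relative class
`w ∈ Hₙ₊₁(W, ∂W)` with `∂w = [∂W]` and `q_* w = j_* [Ŵ]_{μ'}`
(`Literature.Topology.FourManifolds.IsOrientedBoundary`, `NullCobordism.IsOrientedBy`). This file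
relates these data to Spanier's relative fundamental classes
(`Literature.AlgebraicTopology.SingularHomology.IsRelFundamentalClass`), for a null-cobordism
`M = ∂W` with `M` closed, connected and nonempty, `n ≥ 1`, using Hatcher's Prop. 2.22
`q_* : Hⱼ(W, ∂W) ≅ Hⱼ(Ŵ, ∞)` (`ClosedModelHomology.lean`). PROVED here:

* `NullCobordism.eq_zero_of_forall_toLocal_eq_zero_of_ne_infty` — **uniqueness off the cone
  point**: a class of `Hₙ₊₁(Ŵ; G)` whose local images vanish at every point `≠ ∞` is zero
  (`Hₙ₊₁(Ŵ) ↪ Hₙ₊₁(Ŵ, N_ε) = Hₙ₊₁(Ŵ | Ŵ ∖ N_ε)` for a contractible cone neighbourhood `N_ε`, and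
  Hatcher's Lemma 3.27 on the compactum `Ŵ ∖ N_ε ∌ ∞`, `ClosedModel.ptDetermined_of_isCompact`);
* `NullCobordism.closedModelClass` — the class `c_w = j⁻¹ q_* w ∈ Hₙ₊₁(Ŵ; R)` of a relative class
  `w`, and `toLocal (q y) c_w ↔ w|_y` at interior points;
* `NullCobordism.closedModelOrientation` — **a relative fundamental class of `(W, ∂W)` with
  connected boundary orients the closed model**: the local images of `c_w` are generators at every
  point of `Ŵ`, at `∞` by the cone computation `Hₙ₊₁(Ŵ | ∞) ≅ Hₙ₊₁(N, N ∖ ∞) ≅ Hₙ(N ∖ ∞) ≅ Hₙ(∂W)`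
  under which `c_w|_∞` corresponds to `±∂w = ±[∂W]`; `c_w` is its fundamental class;
* `NullCobordism.IsOrientedBy.isFundamentalClass_fundamentalClass`,
  `NullCobordism.IsOrientedBy.exists_isRelFundamentalClass` — conversely, oriented-boundary data
  `(μ, μ', w)` force `[Ŵ]_{μ'}` to be a genuine fundamental class, `w` to be a relative fundamental
  class with `[Ŵ]_{μ'} = c_w`, and `∂w = incl_* [M]_μ`; and
  `NullCobordism.isOrientedBy_closedModelOrientation` — a relative fundamental class `w` over `ℤ`
  yields such data (`closedModelOrientation w`, the boundary orientation of `∂w` moved to `M`).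

No named facts are introduced; nothing else is asserted.

Relation to `ClosedModelOrientation.lean` (landed independently the same day): that file orients
the closed model and produces `IsOrientedBy` data **assuming `Ŵ` is a connected topological
manifold** (`[ChartedSpace (EuclideanSpace ℝ (Fin (n + 1))) (ClosedModel n W)]`, available for
homotopy-sphere boundaries only through `HomotopySphere.nonempty_chartedSpace_closedModel`, i.e.
the generalised Poincaré conjecture / Milnor's Prop. B), by continuation of zeros on `Ŵ`. Here no
atlas on `Ŵ` is used: the generator at `∞` comes from the cone computation over the collar, for
**any** compact `W` with connected nonempty boundary in dimension `n + 1 ≥ 2`, and uniqueness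
off `∞` replaces connectedness of `Ŵ`. The two constructions are logically independent; the
names differ (`NullCobordism.closedModelOrientation` here takes a collar).

## References

* M. Kervaire, J. Milnor, *Groups of homotopy spheres I*, Ann. of Math. 77 (1963), §7, footnote
  pp. 528–529. [KervaireMilnorAnnals1963]
* A. Hatcher, *Algebraic Topology*, CUP 2002, Prop. 2.22, Lemma 3.27, p. 253 (relative
  fundamental classes), Thm. 3.26. [HatcherAT2002]
* E. H. Spanier, *Algebraic Topology*, Springer 1981, Ch. 6 §3 (fundamental classes of manifolds
  with boundary, Cor. 10). [Spanier1981]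
-/

open scoped Manifold ContDiff Topology
open Set Function Filter CategoryTheory Limits
open Literature.AlgebraicTopology.SingularHomology

noncomputable section

namespace Literature.Topology.FourManifolds

universe v

/-! ### Generalities -/

section General

variable (R : Type v) [CommRing R] (G : Type v) [AddCommGroup G] [Module R G]

variable {X Y : Type} [TopologicalSpace X] [TopologicalSpace Y]

/-- **A homotopy equivalence induces isomorphisms on singular homology** (Hatcher 2002,
Cor. 2.11). [cite: HatcherAT2002, §2.1, Cor. 2.11] -/
theorem isIso_map_of_homotopyEquiv (e : ContinuousMap.HomotopyEquiv X Y) (k : ℕ) :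
    IsIso (singularHomology.map R G (e.toFun) k) := by
  refine ⟨⟨singularHomology.map R G e.invFun k, ?_, ?_⟩⟩
  · rw [← singularHomology.map_comp, singularHomology.map_eq_of_homotopic R G e.left_inv k,
      singularHomology.map_id]
  · rw [← singularHomology.map_comp, singularHomology.map_eq_of_homotopic R G e.right_inv k,
      singularHomology.map_id]

/-- If `Hₖ(↥A) = 0` (e.g. `A` contractible, `k ≠ 0`) then `j_* : Hₖ(X) → Hₖ(X, A)` is injective
(exact sequence of the pair). [cite: HatcherAT2002, Thm. 2.16] -/
theorem mono_ofAbsolute_of_isZero (A : Set X) (k : ℕ) (h : IsZero (singularHomology R G (↥A) k)) :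
    Mono (relativeSingularHomology.ofAbsolute R G X A k) :=
  (relativeSingularHomology.exact_map_ofAbsolute R G A k).mono_g (h.eq_of_src _ _)

/-- If `Hₖ(↥A) = 0` and `Hₖ₋₁(↥A) = 0`-part: for `k = j + 1`, if `Hⱼ₊₁(↥A) = 0` and `Hⱼ(↥A) = 0` then
`j_* : Hⱼ₊₁(X) → Hⱼ₊₁(X, A)` is an isomorphism (exact sequence of the pair). [cite: HatcherAT2002, Thm. 2.16] -/
theorem isIso_ofAbsolute_of_isZero (A : Set X) (j : ℕ)
    (h₁ : IsZero (singularHomology R G (↥A) (j + 1))) (h₀ : IsZero (singularHomology R G (↥A) j)) :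
    IsIso (relativeSingularHomology.ofAbsolute R G X A (j + 1)) := by
  haveI := mono_ofAbsolute_of_isZero R G A (j + 1) h₁
  haveI : Epi (relativeSingularHomology.ofAbsolute R G X A (j + 1)) :=
    (relativeSingularHomology.exact_ofAbsolute_δ R G A j).epi_f (h₀.eq_of_tgt _ _)
  exact isIso_of_mono_of_epi _

/-- **Hatcher's `P(K)` in Mathlib's model**: if `P(K)` holds for the concrete local homology
(`clocalHomology.PtDetermined`), a class of `Hₙ(X | K; G)` (Mathlib's model) restricting to zero at
every point of `K` is zero (comparison isomorphism `localHomologyOfSet.cmpIso`, natural under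
restriction). [cite: HatcherAT2002, Lemma 3.27] -/
theorem localHomologyOfSet.eq_zero_of_ptDetermined {X : Type} [TopologicalSpace X] {n : ℕ}
    {K : Set X} (hP : clocalHomology.PtDetermined R G X n K) (β : localHomologyOfSet R G X K n)
    (h : ∀ (x : X) (hx : x ∈ K), restrictToPoint R G hx n β = 0) : β = 0 := by
  have hγ : (localHomologyOfSet.cmpIso R G X K n).hom β = 0 := by
    refine hP.2 _ fun x hx => ?_
    rw [← ModuleCat.comp_apply, localHomologyOfSet.cmpIso_hom_comp_res, ModuleCat.comp_apply]
    change (localHomologyOfSet.cmpIso R G X {x} n).hom (restrictToPoint R G hx n β) = 0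
    rw [h x hx, map_zero]
  have := congrArg (localHomologyOfSet.cmpIso R G X K n).inv hγ
  rwa [Iso.hom_inv_id_apply, map_zero] at this

end General

namespace NullCobordism

variable {n : ℕ} {M : Type} [TopologicalSpace M] [ChartedSpace (EuclideanSpace ℝ (Fin n)) M]
  (c : NullCobordism.{0} n M)

/-! ### Uniqueness off the cone point -/

section UniquenessOffInfty

variable [IsManifold (𝓡 n) ∞ M] (κ : c.boundaryData.Collar) [Nonempty M] [CompactSpace M]
  (R : Type v) [CommRing R] (G : Type v) [AddCommGroup G] [Module R G]

omit [Nonempty M] in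
/-- The complement `K = Ŵ ∖ N_1` of the open cone neighbourhood is compact and avoids `∞`.
[folklore] -/
theorem isCompact_compl_coneNhd : IsCompact (c.coneNhd κ 1)ᶜ :=
  ((c.isOpen_coneNhd κ one_pos le_rfl).isClosed_compl).isCompact

include κ in
/-- **Uniqueness off the cone point.** A class `α ∈ Hₙ₊₁(Ŵ; G)` of the closed model of a
null-cobordism (compact `W` with a collar, `∂W ≠ ∅`) whose image in `Hₙ₊₁(Ŵ | x; G)` vanishes for
every `x ≠ ∞` is zero: `Hₙ₊₁(Ŵ) → Hₙ₊₁(Ŵ, N_1)` is injective (`N_1` is contractible), and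
`Hₙ₊₁(Ŵ, N_1) = Hₙ₊₁(Ŵ | Ŵ ∖ N_1)` is point-determined on the compactum `Ŵ ∖ N_1 ∌ ∞` by
Hatcher's Lemma 3.27 (`ClosedModel.ptDetermined_of_isCompact`). In particular two fundamental
classes agreeing off `∞` coincide, and the local class at `∞` of an orientation of `Ŵ` is
determined by the others. [cite: HatcherAT2002, Lemma 3.27] -/
theorem eq_zero_of_forall_toLocal_eq_zero_of_ne_infty (α : singularHomology R G (ClosedModel n c.W) (n + 1))
    (h : ∀ x : ClosedModel n c.W, x ≠ ClosedModel.infty → singularHomology.toLocal R G x (n + 1) α = 0) :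
    α = 0 := by
  set K : Set (ClosedModel n c.W) := (c.coneNhd κ 1)ᶜ with hK
  -- the image of `α` in `H(Ŵ | K)` vanishes
  have hP : clocalHomology.PtDetermined R G (ClosedModel n c.W) (n + 1) K :=
    ClosedModel.ptDetermined_of_isCompact R G (c.isCompact_compl_coneNhd κ)
      (fun hK' => hK' (c.infty_mem_coneNhd κ 1))
  have hβ : singularHomology.toLocalOfSet R G (ClosedModel n c.W) K (n + 1) α = 0 := by
    refine localHomologyOfSet.eq_zero_of_ptDetermined R G hP _ fun x hx => ?_
    rw [singularHomology.restrictToPoint_toLocalOfSet]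
    exact h x fun hx' => hx (hx' ▸ c.infty_mem_coneNhd κ 1)
  -- `H(Ŵ) → H(Ŵ, N_1)` is injective
  have hKc : Kᶜ = c.coneNhd κ 1 := compl_compl _
  haveI : IsZero (singularHomology R G (↥(c.coneNhd κ 1)) (n + 1)) :=
    haveI := c.contractibleSpace_coneNhd κ (le_refl (1 : ℝ))
    isZero_singularHomology_of_contractibleSpace R G (X := ↥(c.coneNhd κ 1)) (Nat.succ_ne_zero n)
  haveI hmono := mono_ofAbsolute_of_isZero R G (c.coneNhd κ 1) (n + 1) this
  have hβ' : relativeSingularHomology.ofAbsolute R G (ClosedModel n c.W) (c.coneNhd κ 1) (n + 1) α = 0 := by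
    have e : singularHomology.toLocalOfSet R G (ClosedModel n c.W) K (n + 1) =
        relativeSingularHomology.ofAbsolute R G (ClosedModel n c.W) Kᶜ (n + 1) := rfl
    rw [e] at hβ
    rw [← hKc]
    exact hβ
  exact (ModuleCat.mono_iff_injective _).1 hmono (by rw [hβ', map_zero])

end UniquenessOffInfty

/-! ### The class `c_w = j⁻¹ q_* w` of a relative class on the closed model -/

section ClosedModelClass

variable (R : Type v) [CommRing R] (G : Type v) [AddCommGroup G] [Module R G]

/-- `j_* : Hₙ₊₁(Ŵ) → Hₙ₊₁(Ŵ, ∞)` is an isomorphism for `n ≥ 1` (exact sequence of the pair,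
`H₊({∞}) = 0` in positive degrees). [cite: HatcherAT2002, Thm. 2.16] -/
theorem isIso_ofAbsolute_infty_of_le (hn : 1 ≤ n) :
    IsIso (relativeSingularHomology.ofAbsolute R G (ClosedModel n c.W) {ClosedModel.infty} (n + 1)) :=
  isIso_ofAbsolute_of_isZero R G _ n
    (isZero_singularHomology_of_subsingleton R G (X := ↥({ClosedModel.infty} : Set (ClosedModel n c.W)))
      (Nat.succ_ne_zero n))
    (isZero_singularHomology_of_subsingleton R G (X := ↥({ClosedModel.infty} : Set (ClosedModel n c.W)))
      (by omega))

/-- **The class `c_w = j⁻¹ q_* w ∈ Hₙ₊₁(Ŵ)` of a relative class `w ∈ Hₙ₊₁(W, ∂W)`** (`n ≥ 1`): the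
absolute class of the closed model corresponding to `w` under `q_* : Hₙ₊₁(W, ∂W) → Hₙ₊₁(Ŵ, ∞)`
(Hatcher Prop. 2.22) and `j_* : Hₙ₊₁(Ŵ) ≅ Hₙ₊₁(Ŵ, ∞)`. For `W` oriented by `[W, ∂W] = w` this is
the fundamental class `[Ŵ]` of Kervaire–Milnor's closed homology manifold `W ∪ cone(bW)`
(1963, footnote pp. 528–529). [cite: KervaireMilnorAnnals1963, §7, footnote pp. 528–529] -/
def closedModelClass (hn : 1 ≤ n)
    (w : relativeSingularHomology R G c.W ((𝓡∂ (n + 1)).boundary c.W) (n + 1)) :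
    singularHomology R G (ClosedModel n c.W) (n + 1) :=
  haveI := c.isIso_ofAbsolute_infty_of_le R G hn
  inv (relativeSingularHomology.ofAbsolute R G (ClosedModel n c.W) {ClosedModel.infty} (n + 1))
    (relativeSingularHomology.map R G (boundaryCollapse n c.W) (mapsTo_boundaryCollapse n c.W)
      (n + 1) w)

/-- `j_* c_w = q_* w`. [folklore] -/
@[simp] theorem ofAbsolute_closedModelClass (hn : 1 ≤ n)
    (w : relativeSingularHomology R G c.W ((𝓡∂ (n + 1)).boundary c.W) (n + 1)) :
    relativeSingularHomology.ofAbsolute R G (ClosedModel n c.W) {ClosedModel.infty} (n + 1)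
        (c.closedModelClass R G hn w) =
      relativeSingularHomology.map R G (boundaryCollapse n c.W) (mapsTo_boundaryCollapse n c.W)
        (n + 1) w := by
  haveI := c.isIso_ofAbsolute_infty_of_le R G hn
  rw [closedModelClass, ← ModuleCat.comp_apply, IsIso.inv_hom_id, ModuleCat.id_apply]

/-- `c_w` is characterised by `j_* c_w = q_* w`. [folklore] -/
theorem eq_closedModelClass_of_ofAbsolute_eq (hn : 1 ≤ n)
    (w : relativeSingularHomology R G c.W ((𝓡∂ (n + 1)).boundary c.W) (n + 1))
    {α : singularHomology R G (ClosedModel n c.W) (n + 1)}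
    (hα : relativeSingularHomology.ofAbsolute R G (ClosedModel n c.W) {ClosedModel.infty} (n + 1) α =
      relativeSingularHomology.map R G (boundaryCollapse n c.W) (mapsTo_boundaryCollapse n c.W)
        (n + 1) w) :
    α = c.closedModelClass R G hn w := by
  haveI := c.isIso_ofAbsolute_infty_of_le R G hn
  apply (ModuleCat.mono_iff_injective
    (relativeSingularHomology.ofAbsolute R G (ClosedModel n c.W) {ClosedModel.infty} (n + 1))).1
    inferInstance
  rw [hα, ofAbsolute_closedModelClass]

/-- `c_w` is additive in `w` (it is a composite of linear maps). [folklore] -/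
theorem closedModelClass_neg (hn : 1 ≤ n)
    (w : relativeSingularHomology R G c.W ((𝓡∂ (n + 1)).boundary c.W) (n + 1)) :
    c.closedModelClass R G hn (-w) = -c.closedModelClass R G hn w := by
  simp only [closedModelClass, map_neg]

/-- An interior point is not a boundary point. [folklore] -/
theorem not_mem_boundary_of_mem_interior {y : c.W} (hy : y ∈ (𝓡∂ (n + 1)).interior c.W) :
    y ∈ ((𝓡∂ (n + 1)).boundary c.W)ᶜ := by
  rw [ModelWithCorners.compl_boundary]; exact hy

/-- **Local images of `c_w` at interior points**: `c_w|_{q y} = q_* (w|_y)` for `y ∈ W ∖ ∂W`, where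
`q_* : Hₙ₊₁(W | y) ≅ Hₙ₊₁(Ŵ | q y)` is the local isomorphism of the collapse. [cite: HatcherAT2002, §3.3 p. 253 (relative fundamental class)] -/
theorem toLocal_closedModelClass_of_mem_interior (hn : 1 ≤ n)
    (w : relativeSingularHomology R G c.W ((𝓡∂ (n + 1)).boundary c.W) (n + 1))
    {y : c.W} (hy : y ∈ (𝓡∂ (n + 1)).interior c.W) :
    singularHomology.toLocal R G (boundaryCollapse n c.W y) (n + 1) (c.closedModelClass R G hn w) =
      relativeSingularHomology.map R G (boundaryCollapse n c.W)
        (c.mapsTo_boundaryCollapse_compl_singleton hy) (n + 1)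
        (relativeSingularHomology.toLocal R G ((𝓡∂ (n + 1)).boundary c.W)
          ⟨y, c.not_mem_boundary_of_mem_interior hy⟩ (n + 1) w) := by
  have hqy : boundaryCollapse n c.W y ≠ ClosedModel.infty := by
    rw [boundaryCollapse_of_mem_interior hy]; exact OnePoint.coe_ne_infty _
  have hsub : ({ClosedModel.infty} : Set (ClosedModel n c.W)) ⊆ {boundaryCollapse n c.W y}ᶜ :=
    singleton_subset_iff.2 fun h => hqy (mem_singleton_iff.1 h).symm
  -- `toLocal (q y) = j_* ≫ (id : (Ŵ, ∞) → (Ŵ, Ŵ ∖ q y))_*`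
  have h1 : singularHomology.toLocal R G (boundaryCollapse n c.W y) (n + 1) =
      relativeSingularHomology.ofAbsolute R G (ClosedModel n c.W) {ClosedModel.infty} (n + 1) ≫
        relativeSingularHomology.map R G (ContinuousMap.id _) (mapsTo_id_of_subset hsub) (n + 1) := by
    rw [relativeSingularHomology.ofAbsolute_comp_map, singularHomology.map_id, Category.id_comp]
    rfl
  rw [h1, ModuleCat.comp_apply, ofAbsolute_closedModelClass, ← ModuleCat.comp_apply,
    ← relativeSingularHomology.map_comp, relativeSingularHomology.toLocal, ← ModuleCat.comp_apply,
    ← relativeSingularHomology.map_comp]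
  rfl

/-- **`c_w` restricts to generators at interior points when `w` is a relative fundamental class.**
[cite: HatcherAT2002, §3.3 p. 253 (relative fundamental class)] -/
theorem isGenerator_toLocal_closedModelClass_of_mem_interior (hn : 1 ≤ n)
    {w : relativeSingularHomology R R c.W ((𝓡∂ (n + 1)).boundary c.W) (n + 1)}
    (hw : IsRelFundamentalClass R ((𝓡∂ (n + 1)).boundary c.W) w)
    {y : c.W} (hy : y ∈ (𝓡∂ (n + 1)).interior c.W) :
    ∃ e : localHomology R R (ClosedModel n c.W) (boundaryCollapse n c.W y) (n + 1) ≃ₗ[R] R,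
      e (singularHomology.toLocal R R (boundaryCollapse n c.W y) (n + 1)
        (c.closedModelClass R R hn w)) = 1 := by
  rw [c.toLocal_closedModelClass_of_mem_interior R R hn w hy]
  haveI := c.isIso_localMap_boundaryCollapse R R hy (n + 1)
  exact (exists_linearEquiv_apply_eq_one_iff_of_isIso _ _).2
    (hw ⟨y, c.not_mem_boundary_of_mem_interior hy⟩)

end ClosedModelClass

/-! ### The cone computation at `∞`: auxiliary isomorphisms -/

section ConeAux

variable [IsManifold (𝓡 n) ∞ M] (κ : c.boundaryData.Collar)
  (R : Type v) [CommRing R] (G : Type v) [AddCommGroup G] [Module R G]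

/-- The **punctured cone neighbourhood** `N_1 ∖ {∞} = q(κ(∂W × (0, 1)))`. [folklore] -/
def pCone : Set (ClosedModel n c.W) := c.coneNhd κ 1 ∩ {ClosedModel.infty}ᶜ

/-- `N_1 ∖ ∞ ⊆ N_1`. [folklore] -/
theorem pCone_subset_coneNhd : c.pCone κ ⊆ c.coneNhd κ 1 := inter_subset_left

/-- `N_1 ∖ ∞ ⊆ Ŵ ∖ ∞`. [folklore] -/
theorem pCone_subset_compl_infty : c.pCone κ ⊆ {ClosedModel.infty}ᶜ := inter_subset_right

/-- In `N_1`, the subset `N_1 ∖ ∞` is the complement of `∞`. [folklore] -/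
theorem preimage_val_pCone :
    (Subtype.val ⁻¹' c.pCone κ : Set ↥(c.coneNhd κ 1)) = Subtype.val ⁻¹' {ClosedModel.infty}ᶜ := by
  ext z
  exact ⟨fun h => h.2, fun h => ⟨z.2, h⟩⟩

/-- In `Ŵ ∖ ∞`, the subset `N_1` is `N_1 ∖ ∞`. [folklore] -/
theorem preimage_val_coneNhd_eq :
    (Subtype.val ⁻¹' c.coneNhd κ 1 : Set ↥({ClosedModel.infty}ᶜ : Set (ClosedModel n c.W))) =
      Subtype.val ⁻¹' c.pCone κ := by
  ext z
  exact ⟨fun h => ⟨h, z.2⟩, fun h => h.1⟩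

/-- `Ŵ ∖ ∞ ↪ Ŵ` is a map of pairs `(Ŵ ∖ ∞, N_1 ∖ ∞) → (Ŵ, N_1 ∖ ∞)`. [folklore] -/
theorem mapsTo_subsetIncl_compl_infty_pCone :
    MapsTo (subsetIncl ({ClosedModel.infty}ᶜ : Set (ClosedModel n c.W)))
      (Subtype.val ⁻¹' c.coneNhd κ 1) (c.pCone κ) := fun z hz => ⟨hz, z.2⟩

/-- (r₁) The restriction `↥(N_1 ↓∩ (N_1 ∖ ∞)) → ↥(N_1 ∖ ∞)` of the inclusion is a homeomorphism, hence
an isomorphism on homology. [folklore] -/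
theorem isIso_map_restrict_val_pCone (k : ℕ) :
    IsIso (singularHomology.map R G (subsetRestrict
      (⟨Subtype.val, continuous_subtype_val⟩ : C(↥(c.coneNhd κ 1), ClosedModel n c.W))
      (mapsTo_val_preimage (c.coneNhd κ 1) (c.pCone κ))) k) := by
  have e : subsetRestrict (⟨Subtype.val, continuous_subtype_val⟩ : C(↥(c.coneNhd κ 1), ClosedModel n c.W))
      (mapsTo_val_preimage (c.coneNhd κ 1) (c.pCone κ)) =
      (preimageValHomeomorphOfSubset (c.pCone_subset_coneNhd κ) : C(_, ↥(c.pCone κ))) := by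
    ext z; rfl
  rw [e]
  exact (singularHomology.mapIso R G (preimageValHomeomorphOfSubset (c.pCone_subset_coneNhd κ)) k).isIso_hom

/-- (r₂) The restriction `↥((Ŵ ∖ ∞) ↓∩ N_1) → ↥(N_1 ∖ ∞)` of the inclusion is a homeomorphism, hence an
isomorphism on homology. [folklore] -/
theorem isIso_map_restrict_incl_pCone (k : ℕ) :
    IsIso (singularHomology.map R G (subsetRestrict
      (subsetIncl ({ClosedModel.infty}ᶜ : Set (ClosedModel n c.W)))
      (c.mapsTo_subsetIncl_compl_infty_pCone κ)) k) := by
  set h : ↥(Subtype.val ⁻¹' c.coneNhd κ 1 : Set ↥({ClosedModel.infty}ᶜ : Set (ClosedModel n c.W))) ≃ₜ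
      ↥(c.pCone κ) :=
    (Homeomorph.setCongr (c.preimage_val_coneNhd_eq κ)).trans
      (preimageValHomeomorphOfSubset (c.pCone_subset_compl_infty κ)) with hh
  have e : subsetRestrict (subsetIncl ({ClosedModel.infty}ᶜ : Set (ClosedModel n c.W)))
      (c.mapsTo_subsetIncl_compl_infty_pCone κ) = (h : C(_, ↥(c.pCone κ))) := by
    ext z; rfl
  rw [e]
  exact (singularHomology.mapIso R G h k).isIso_hom

/-- (h) The collapse homeomorphism `W ∖ ∂W ≅ Ŵ ∖ ∞` restricts to a homeomorphism
`C_1 ∖ ∂W ≅ (Ŵ ∖ ∞) ↓∩ N_1`. [folklore] -/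
def interiorHomeoCollar :
    ↥(Subtype.val ⁻¹' c.collarNhd κ 1 : Set ↥(((𝓡∂ (n + 1)).boundary c.W)ᶜ)) ≃ₜ
      ↥(Subtype.val ⁻¹' c.coneNhd κ 1 : Set ↥({ClosedModel.infty}ᶜ : Set (ClosedModel n c.W))) :=
  c.interiorHomeo.subtype fun x => by
    change x.1 ∈ c.collarNhd κ 1 ↔ (c.interiorHomeo x : ClosedModel n c.W) ∈ c.coneNhd κ 1
    rw [interiorHomeo_apply_coe]
    exact (c.ofInterior_mem_coneNhd_iff κ ⟨x.1, c.mem_interior_of_mem_compl_boundary x.2⟩).symm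

/-- The restricted homeomorphism is the restriction of `interiorHomeo`. [folklore] -/
theorem subsetRestrict_interiorHomeo_eq :
    subsetRestrict (c.interiorHomeo : C(↥(((𝓡∂ (n + 1)).boundary c.W)ᶜ),
        ↥({ClosedModel.infty}ᶜ : Set (ClosedModel n c.W)))) (c.mapsTo_interiorHomeo κ 1) =
      (c.interiorHomeoCollar κ : C(_, _)) := by
  ext z; rfl

/-- (h) The restriction of `interiorHomeo` to the punctured collar is an isomorphism on homology.
[folklore] -/
theorem isIso_map_restrict_interiorHomeo (k : ℕ) :
    IsIso (singularHomology.map R G (subsetRestrict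
      (c.interiorHomeo : C(↥(((𝓡∂ (n + 1)).boundary c.W)ᶜ),
        ↥({ClosedModel.infty}ᶜ : Set (ClosedModel n c.W)))) (c.mapsTo_interiorHomeo κ 1)) k) := by
  rw [subsetRestrict_interiorHomeo_eq]
  exact (singularHomology.mapIso R G (c.interiorHomeoCollar κ) k).isIso_hom

variable [Nonempty M]

/-- (r₄) **`Hₖ(∂W) ≅ Hₖ(C_ε)`**: the inclusion of the boundary into a collar neighbourhood is an
isomorphism on homology (`H₊(C_ε, ∂W) = 0`, exact sequence of the pair). [cite: HatcherAT2002, §2.1, Prop. 2.22 (proof)] -/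
theorem isIso_map_subsetIncl_boundary_collarNhd (ε : ℝ) (k : ℕ) :
    IsIso (singularHomology.map R G
      (subsetIncl (Subtype.val ⁻¹' (𝓡∂ (n + 1)).boundary c.W : Set ↥(c.collarNhd κ ε))) k) := by
  have h0 := c.isZero_rel_collarNhd_boundary κ R G ε k
  have h1 := c.isZero_rel_collarNhd_boundary κ R G ε (k + 1)
  haveI : Mono (singularHomology.map R G
      (subsetIncl (Subtype.val ⁻¹' (𝓡∂ (n + 1)).boundary c.W : Set ↥(c.collarNhd κ ε))) k) :=
    (relativeSingularHomology.exact_δ_map R G _ k).mono_g (h1.eq_of_src _ _)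
  haveI : Epi (singularHomology.map R G
      (subsetIncl (Subtype.val ⁻¹' (𝓡∂ (n + 1)).boundary c.W : Set ↥(c.collarNhd κ ε))) k) :=
    (relativeSingularHomology.exact_map_ofAbsolute R G _ k).epi_f (h0.eq_of_tgt _ _)
  exact isIso_of_mono_of_epi _

/-- (r₄) The inclusion `∂W ↪ C_ε` (`ε > 0`), as the restriction of the identity, is an isomorphism
on homology. [cite: HatcherAT2002, §2.1, Prop. 2.22 (proof)] -/
theorem isIso_map_restrict_boundary_collarNhd {ε : ℝ} (hε : 0 < ε) (k : ℕ) :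
    IsIso (singularHomology.map R G (subsetRestrict (ContinuousMap.id c.W)
      (mapsTo_id_of_subset (c.boundary_subset_collarNhd κ hε))) k) := by
  have e : subsetRestrict (ContinuousMap.id c.W) (mapsTo_id_of_subset (c.boundary_subset_collarNhd κ hε)) =
      (subsetIncl (Subtype.val ⁻¹' (𝓡∂ (n + 1)).boundary c.W : Set ↥(c.collarNhd κ ε))).comp
        ((preimageValHomeomorphOfSubset (c.boundary_subset_collarNhd κ hε)).symm :
          C(↥((𝓡∂ (n + 1)).boundary c.W), _)) := by
    ext z; rfl
  rw [e, singularHomology.map_comp]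
  haveI := c.isIso_map_subsetIncl_boundary_collarNhd κ R G ε k
  refine @IsIso.comp_isIso _ _ _ _ _ _ _ ?_ inferInstance
  exact (singularHomology.mapIso R G
    (preimageValHomeomorphOfSubset (c.boundary_subset_collarNhd κ hε)).symm k).isIso_hom

/-- `(1 + t)/2 ∈ [1/2, 1]` for `t ∈ [0, 1]`: pushing collar parameters up, off the boundary. [folklore] -/
def halfUp (t : Set.Icc (0 : ℝ) 1) : Set.Icc (0 : ℝ) 1 :=
  ⟨(1 + t) / 2, by constructor <;> linarith [t.2.1, t.2.2]⟩

omit [TopologicalSpace M] [ChartedSpace (EuclideanSpace ℝ (Fin n)) M] c in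
/-- `halfUp t = (1 + t)/2`. [folklore] -/
@[simp] theorem coe_halfUp (t : Set.Icc (0 : ℝ) 1) : (halfUp t : ℝ) = (1 + t) / 2 := rfl

/-- The convex combination `(1 - s) a + s b` of two collar parameters. [folklore] -/
def iccConv (s : unitInterval) (a b : Set.Icc (0 : ℝ) 1) : Set.Icc (0 : ℝ) 1 :=
  ⟨(1 - (s : ℝ)) * a + s * b, by
    constructor <;> nlinarith [s.2.1, s.2.2, a.2.1, a.2.2, b.2.1, b.2.2]⟩

omit [TopologicalSpace M] [ChartedSpace (EuclideanSpace ℝ (Fin n)) M] c in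
/-- `iccConv s a b = (1 - s) a + s b`. [folklore] -/
@[simp] theorem coe_iccConv (s : unitInterval) (a b : Set.Icc (0 : ℝ) 1) :
    (iccConv s a b : ℝ) = (1 - (s : ℝ)) * a + s * b := rfl

omit [TopologicalSpace M] [ChartedSpace (EuclideanSpace ℝ (Fin n)) M] c in
/-- At time `0` the combination is the first parameter. [folklore] -/
@[simp] theorem iccConv_zero (a b : Set.Icc (0 : ℝ) 1) : iccConv 0 a b = a :=
  Subtype.ext (by simp)

omit [TopologicalSpace M] [ChartedSpace (EuclideanSpace ℝ (Fin n)) M] c in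
/-- At time `1` the combination is the second parameter. [folklore] -/
@[simp] theorem iccConv_one (a b : Set.Icc (0 : ℝ) 1) : iccConv 1 a b = b :=
  Subtype.ext (by simp)

omit [TopologicalSpace M] [ChartedSpace (EuclideanSpace ℝ (Fin n)) M] c in
/-- The combination of two parameters `< 1` is `< 1`. [folklore] -/
theorem coe_iccConv_lt_one (s : unitInterval) {a b : Set.Icc (0 : ℝ) 1} (ha : (a : ℝ) < 1)
    (hb : (b : ℝ) < 1) : (iccConv s a b : ℝ) < 1 := by
  rw [coe_iccConv]
  rcases eq_or_lt_of_le s.2.1 with hs | hs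
  · rw [← hs]; simpa using ha
  · nlinarith [s.2.2]

omit [TopologicalSpace M] [ChartedSpace (EuclideanSpace ℝ (Fin n)) M] c in
/-- The combination of two positive parameters is positive. [folklore] -/
theorem coe_iccConv_pos (s : unitInterval) {a b : Set.Icc (0 : ℝ) 1} (ha : 0 < (a : ℝ))
    (hb : 0 < (b : ℝ)) : 0 < (iccConv s a b : ℝ) := by
  rw [coe_iccConv]
  rcases eq_or_lt_of_le s.2.1 with hs | hs
  · rw [← hs]; simpa using ha
  · nlinarith [s.2.2]

omit [TopologicalSpace M] [ChartedSpace (EuclideanSpace ℝ (Fin n)) M] c in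
/-- Joint continuity of the convex combination. [folklore] -/
theorem continuous_iccConv : Continuous fun p : unitInterval × Set.Icc (0 : ℝ) 1 × Set.Icc (0 : ℝ) 1 =>
    iccConv p.1 p.2.1 p.2.2 := by
  refine Continuous.subtype_mk ?_ _
  fun_prop

/-- The point `κ(x, (1 - s)(1 + t)/2 + s t)` for `w = κ(x, t)`: at `s = 0` the push-up
`κ(x, (1 + t)/2)` off the boundary, at `s = 1` the point `w` itself. [folklore] -/
def collarPush (s : unitInterval) (w : c.W) : c.W :=
  κ ((c.collarInv κ w).1, iccConv s (halfUp (c.collarInv κ w).2) (c.collarInv κ w).2)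

/-- `collarPush` keeps `C_1` inside `C_1`. [folklore] -/
theorem collarPush_mem_collarNhd (s : unitInterval) {w : c.W} (hw : w ∈ c.collarNhd κ 1) :
    c.collarPush κ s w ∈ c.collarNhd κ 1 := by
  refine (c.collar_mem_collarNhd_iff κ _).2 (coe_iccConv_lt_one s ?_ (c.collarInv_snd_lt κ hw))
  rw [coe_halfUp]
  linarith [c.collarInv_snd_lt κ hw]

/-- `collarPush s w` is an interior point as soon as its collar parameter is positive. [folklore] -/
theorem collarPush_mem_compl_boundary (s : unitInterval) (w : c.W)
    (h : 0 < (iccConv s (halfUp (c.collarInv κ w).2) (c.collarInv κ w).2 : ℝ)) :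
    c.collarPush κ s w ∈ (((𝓡∂ (n + 1)).boundary c.W)ᶜ : Set c.W) := by
  rw [ModelWithCorners.compl_boundary]
  refine κ.apply_mem_interior _ (show ⊥ < _ from ?_)
  rw [← Subtype.coe_lt_coe, Set.Icc.coe_bot]
  exact h

omit [TopologicalSpace M] [ChartedSpace (EuclideanSpace ℝ (Fin n)) M] c in
/-- The push-up `κ(x, (1 + t)/2)` (`s = 0`) always has positive parameter. [folklore] -/
theorem iccConv_zero_halfUp_pos (t : Set.Icc (0 : ℝ) 1) : 0 < (iccConv 0 (halfUp t) t : ℝ) := by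
  rw [iccConv_zero, coe_halfUp]; linarith [t.2.1]

omit [TopologicalSpace M] [ChartedSpace (EuclideanSpace ℝ (Fin n)) M] c in
/-- The combination of `(1 + t)/2 > 0` and `t > 0` is positive. [folklore] -/
theorem iccConv_halfUp_pos (s : unitInterval) {t : Set.Icc (0 : ℝ) 1} (ht : 0 < (t : ℝ)) :
    0 < (iccConv s (halfUp t) t : ℝ) :=
  coe_iccConv_pos s (by rw [coe_halfUp]; linarith [t.2.1]) ht

/-- At `s = 1` the push is the identity on the range of the collar. [folklore] -/
theorem collarPush_one {w : c.W} (hw : w ∈ range κ) : c.collarPush κ 1 w = w := by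
  rw [collarPush, iccConv_one, Prod.mk.eta, c.collar_collarInv κ hw]

/-- Joint continuity of `(s, z) ↦ collarPush s (f z)` for `f` continuous with values in `C_1` (where
the collar coordinates are continuous). [folklore] -/
theorem continuous_collarPush_comp {S : Type} [TopologicalSpace S] {f : S → c.W} (hf : Continuous f)
    (hfC : ∀ z, f z ∈ c.collarNhd κ 1) :
    Continuous fun p : unitInterval × S => c.collarPush κ p.1 (f p.2) := by
  have hinv : Continuous fun z : S => c.collarInv κ (f z) :=
    (c.continuousOn_collarInv κ).comp_continuous hf fun z => c.collarNhd_subset_range κ 1 (hfC z)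
  have h2 : Continuous fun p : unitInterval × S => (c.collarInv κ (f p.2)).2 :=
    continuous_snd.comp (hinv.comp continuous_snd)
  have hup : Continuous fun p : unitInterval × S => halfUp (c.collarInv κ (f p.2)).2 := by
    refine Continuous.subtype_mk ?_ _
    exact ((continuous_const.add (continuous_subtype_val.comp h2)).div_const _)
  refine κ.continuous.comp ?_
  refine (continuous_fst.comp (hinv.comp continuous_snd)).prodMk ?_
  exact continuous_iccConv.comp (continuous_fst.prodMk (hup.prodMk h2))

/-- (r₃) **The punctured collar `C_1 ∖ ∂W` is homotopy equivalent to `C_1`**: the inclusion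
`C_1 ∖ ∂W ↪ C_1` is a homotopy equivalence, with homotopy inverse `κ(x, t) ↦ κ(x, (1 + t)/2)` and
straight-line homotopies in the collar parameter. [folklore] -/
def collarInteriorHomotopyEquiv :
    ContinuousMap.HomotopyEquiv
      ↥(Subtype.val ⁻¹' c.collarNhd κ 1 : Set ↥(((𝓡∂ (n + 1)).boundary c.W)ᶜ))
      ↥(c.collarNhd κ 1) where
  toFun := subsetRestrict (subsetIncl (((𝓡∂ (n + 1)).boundary c.W)ᶜ))
    (mapsTo_preimage Subtype.val (c.collarNhd κ 1))
  invFun :=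
    ⟨fun y => ⟨⟨c.collarPush κ 0 y.1, c.collarPush_mem_compl_boundary κ 0 y.1
        (iccConv_zero_halfUp_pos _)⟩, c.collarPush_mem_collarNhd κ 0 y.2⟩,
      ((c.continuous_collarPush_comp κ continuous_subtype_val (fun y => y.2)).comp
        (Continuous.prodMk_right (0 : unitInterval))).subtype_mk _ |>.subtype_mk _⟩
  left_inv := ⟨{
    toFun := fun p => ⟨⟨c.collarPush κ p.1 p.2.1.1, c.collarPush_mem_compl_boundary κ p.1 p.2.1.1
        (iccConv_halfUp_pos p.1 (c.collar_snd_pos_of_mem_interior κ (by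
          rw [c.collar_collarInv κ (c.collarNhd_subset_range κ 1 p.2.2)]
          exact c.mem_interior_of_mem_compl_boundary p.2.1.2)))⟩,
        c.collarPush_mem_collarNhd κ p.1 p.2.2⟩
    continuous_toFun :=
      ((c.continuous_collarPush_comp κ (continuous_subtype_val.comp continuous_subtype_val)
        (fun z => z.2)).subtype_mk _).subtype_mk _
    map_zero_left := fun z => rfl
    map_one_left := fun z => Subtype.ext (Subtype.ext
      (c.collarPush_one κ (c.collarNhd_subset_range κ 1 z.2))) }⟩
  right_inv := ⟨{
    toFun := fun p => ⟨c.collarPush κ p.1 p.2.1, c.collarPush_mem_collarNhd κ p.1 p.2.2⟩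
    continuous_toFun :=
      (c.continuous_collarPush_comp κ continuous_subtype_val (fun y => y.2)).subtype_mk _
    map_zero_left := fun y => rfl
    map_one_left := fun y => Subtype.ext (c.collarPush_one κ (c.collarNhd_subset_range κ 1 y.2)) }⟩

/-- (r₃) The inclusion `C_1 ∖ ∂W ↪ C_1` is an isomorphism on homology. [folklore] -/
theorem isIso_map_restrict_collarInterior (k : ℕ) :
    IsIso (singularHomology.map R G (subsetRestrict (subsetIncl (((𝓡∂ (n + 1)).boundary c.W)ᶜ))
      (mapsTo_preimage Subtype.val (c.collarNhd κ 1))) k) :=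
  isIso_map_of_homotopyEquiv R G (c.collarInteriorHomotopyEquiv κ) k

/-- (δ) **`∂ : Hₖ₊₁(N_1, N_1 ∖ ∞) ≅ Hₖ(N_1 ∖ ∞)`** for `k ≠ 0`: the cone neighbourhood is
contractible. [cite: HatcherAT2002, Thm. 2.16] -/
theorem isIso_δ_coneNhd_pCone [CompactSpace M] {k : ℕ} (hk : k ≠ 0) :
    IsIso (relativeSingularHomology.δ R G (↥(c.coneNhd κ 1)) (Subtype.val ⁻¹' c.pCone κ) k) := by
  haveI := c.contractibleSpace_coneNhd κ (le_refl (1 : ℝ))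
  have h1 : IsZero (singularHomology R G (↥(c.coneNhd κ 1)) (k + 1)) :=
    isZero_singularHomology_of_contractibleSpace R G (Nat.succ_ne_zero k)
  have h0 : IsZero (singularHomology R G (↥(c.coneNhd κ 1)) k) :=
    isZero_singularHomology_of_contractibleSpace R G hk
  haveI : Mono (relativeSingularHomology.δ R G (↥(c.coneNhd κ 1)) (Subtype.val ⁻¹' c.pCone κ) k) :=
    (relativeSingularHomology.exact_ofAbsolute_δ R G _ k).mono_g (h1.eq_of_src _ _)
  haveI : Epi (relativeSingularHomology.δ R G (↥(c.coneNhd κ 1)) (Subtype.val ⁻¹' c.pCone κ) k) :=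
    (relativeSingularHomology.exact_δ_map R G _ k).epi_f (h0.eq_of_tgt _ _)
  exact isIso_of_mono_of_epi _

omit [Nonempty M] in
/-- (e₁) **Excision into the cone neighbourhood**: `Hₖ(N_1, N_1 ∖ ∞) ≅ Hₖ(Ŵ, Ŵ ∖ ∞) = Hₖ(Ŵ | ∞)`
(Hatcher Thm. 2.20: the open sets `N_1` and `Ŵ ∖ ∞` cover). [cite: HatcherAT2002, Thm. 2.20] -/
theorem isIso_map_subsetIncl_coneNhd_compl_infty [CompactSpace M] (k : ℕ) :
    IsIso (relativeSingularHomology.map R G (subsetIncl (c.coneNhd κ 1))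
      (mapsTo_preimage Subtype.val ({ClosedModel.infty}ᶜ : Set (ClosedModel n c.W))) k) := by
  refine relativeSingularHomology.isIso_map_of_interior_union_interior_holds R G (ClosedModel n c.W)
    {ClosedModel.infty}ᶜ (c.coneNhd κ 1) ?_ k
  have ho : IsOpen ({ClosedModel.infty}ᶜ : Set (ClosedModel n c.W)) :=
    OnePoint.isClosed_infty.isOpen_compl
  rw [ho.interior_eq, (c.isOpen_coneNhd κ one_pos le_rfl).interior_eq]
  refine eq_univ_of_forall fun x => ?_
  by_cases hx : x = ClosedModel.infty
  · exact Or.inr (hx ▸ c.infty_mem_coneNhd κ 1)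
  · exact Or.inl hx

/-! ### The cone computation at `∞`: the chase -/

omit [IsManifold (𝓡 n) ∞ M] [Nonempty M] in
/-- Elementwise naturality of the connecting map: `(f|)_* (∂ x) = ∂ (f_* x)`. [cite: HatcherAT2002, §2.1 (naturality of ∂)] -/
theorem map_δ_apply {X Y : Type} [TopologicalSpace X] [TopologicalSpace Y] {A : Set X} {B : Set Y}
    (f : C(X, Y)) (h : MapsTo f A B) (k : ℕ) (x : relativeSingularHomology R G X A (k + 1)) :
    singularHomology.map R G (subsetRestrict f h) k (relativeSingularHomology.δ R G X A k x) =
      relativeSingularHomology.δ R G Y B k (relativeSingularHomology.map R G f h (k + 1) x) := by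
  rw [← ModuleCat.comp_apply, relativeSingularHomology.δ_naturality, ModuleCat.comp_apply]

omit [IsManifold (𝓡 n) ∞ M] [Nonempty M] in
/-- `∂ (j_* x) = 0` elementwise. [cite: HatcherAT2002, Thm. 2.16] -/
theorem δ_ofAbsolute_apply {X : Type} [TopologicalSpace X] (A : Set X) (k : ℕ)
    (x : singularHomology R G X (k + 1)) :
    relativeSingularHomology.δ R G X A k (relativeSingularHomology.ofAbsolute R G X A (k + 1) x) = 0 := by
  rw [← ModuleCat.comp_apply, relativeSingularHomology.ofAbsolute_comp_δ]; rfl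

omit [IsManifold (𝓡 n) ∞ M] [Nonempty M] in
/-- A map of pairs `(↥S, T) → (X, A)` induced by the inclusion of `S ⊆ A` is zero on relative
homology: it factors through `H₊(↥S, ↥S) = 0`. [cite: HatcherAT2002, §2.1 (Hₙ(X, X) = 0)] -/
theorem map_subsetIncl_eq_zero_of_forall_mem {X : Type} [TopologicalSpace X] (S A : Set X)
    (T : Set ↥S) (hSA : ∀ z : ↥S, z.1 ∈ A) (h : MapsTo (subsetIncl S) T A) (k : ℕ) :
    relativeSingularHomology.map R G (subsetIncl S) h k = 0 := by
  have f1 : MapsTo (ContinuousMap.id ↥S) T univ := fun _ _ => mem_univ _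
  have f2 : MapsTo (subsetIncl S) (univ : Set ↥S) A := fun z _ => hSA z
  have e : relativeSingularHomology.map R G (subsetIncl S) h k =
      relativeSingularHomology.map R G (ContinuousMap.id ↥S) f1 k ≫
        relativeSingularHomology.map R G (subsetIncl S) f2 k := by
    rw [← relativeSingularHomology.map_comp]
    exact relativeSingularHomology.map_congr R G (ContinuousMap.comp_id _).symm _ _ k
  rw [e, (isZero_relativeSingularHomology_univ R G k).eq_of_src
    (relativeSingularHomology.map R G (subsetIncl S) f2 k) 0, comp_zero]

include κ in
/-- **The cone computation.** For `n ≥ 1` and any relative class `w ∈ Hₙ₊₁(W, ∂W; R)` whose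
boundary `∂w` generates `Hₙ(∂W; R)`, the class `c_w = j⁻¹ q_* w` of the closed model restricts to a
generator of the local homology `Hₙ₊₁(Ŵ | ∞; R)` at the cone point. Route:
`Hₙ₊₁(Ŵ | ∞) ≅ Hₙ₊₁(N, N ∖ ∞)` (excision into the cone neighbourhood `N = N_1`)
`≅ Hₙ(N ∖ ∞)` (`N` contractible) `≅ Hₙ(C_1 ∖ ∂W) ≅ Hₙ(C_1) ≅ Hₙ(∂W)` (collapse homeomorphism,
collar retractions), under which `c_w|_∞` corresponds to `-∂w` (exact sequence of the triple
`N ∖ ∞ ⊆ N ⊆ Ŵ` and naturality of `∂`). Kervaire–Milnor 1963, footnote pp. 528–529: at the cone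
point over a homology sphere `bW` the closed model is a homology manifold.
[cite: KervaireMilnorAnnals1963, §7, footnote pp. 528–529] -/
theorem isGenerator_toLocal_closedModelClass_infty_of [CompactSpace M] (hn : 1 ≤ n)
    (w : relativeSingularHomology R R c.W ((𝓡∂ (n + 1)).boundary c.W) (n + 1))
    (hδ : ∃ e : singularHomology R R ↥((𝓡∂ (n + 1)).boundary c.W) n ≃ₗ[R] R,
      e (relativeSingularHomology.δ R R c.W ((𝓡∂ (n + 1)).boundary c.W) n w) = 1) :
    ∃ e : localHomology R R (ClosedModel n c.W) ClosedModel.infty (n + 1) ≃ₗ[R] R,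
      e (singularHomology.toLocal R R ClosedModel.infty (n + 1) (c.closedModelClass R R hn w)) = 1 := by
  obtain ⟨n, rfl⟩ : ∃ m, n = m + 1 := ⟨n - 1, by omega⟩
  -- the isomorphisms of `ClosedModelHomology`
  haveI iW := c.isIso_map_subsetIncl_compl_boundary κ R R one_pos le_rfl (n + 1 + 1)
  haveI iX := c.isIso_map_subsetIncl_compl_infty κ R R one_pos le_rfl (n + 1 + 1)
  -- maps of pairs
  have hBC : (𝓡∂ (n + 1 + 1)).boundary c.W ⊆ c.collarNhd κ 1 := c.boundary_subset_collarNhd κ one_pos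
  have hPN : c.pCone κ ⊆ c.coneNhd κ 1 := c.pCone_subset_coneNhd κ
  have hPZ : c.pCone κ ⊆ ({ClosedModel.infty}ᶜ : Set (ClosedModel (n + 1) c.W)) :=
    c.pCone_subset_compl_infty κ
  have hIN : ({ClosedModel.infty} : Set (ClosedModel (n + 1) c.W)) ⊆ c.coneNhd κ 1 :=
    singleton_subset_iff.2 (c.infty_mem_coneNhd κ 1)
  have m_NPZ : MapsTo (subsetIncl (c.coneNhd κ 1)) (Subtype.val ⁻¹' c.pCone κ)
      ({ClosedModel.infty}ᶜ : Set (ClosedModel (n + 1) c.W)) := fun z hz => hz.2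
  -- Step 1: `w'` with `eW w' = a w`
  obtain ⟨w', hw'⟩ : ∃ w' : relativeSingularHomology R R ↥(((𝓡∂ (n + 1 + 1)).boundary c.W)ᶜ)
      (Subtype.val ⁻¹' c.collarNhd κ 1) (n + 1 + 1),
      relativeSingularHomology.map R R (subsetIncl (((𝓡∂ (n + 1 + 1)).boundary c.W)ᶜ))
        (mapsTo_preimage Subtype.val (c.collarNhd κ 1)) (n + 1 + 1) w' =
      relativeSingularHomology.map R R (ContinuousMap.id c.W) (mapsTo_id_of_subset hBC) (n + 1 + 1) w :=
    ⟨inv (relativeSingularHomology.map R R (subsetIncl (((𝓡∂ (n + 1 + 1)).boundary c.W)ᶜ))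
        (mapsTo_preimage Subtype.val (c.collarNhd κ 1)) (n + 1 + 1))
        (relativeSingularHomology.map R R (ContinuousMap.id c.W) (mapsTo_id_of_subset hBC) (n + 1 + 1) w),
      by rw [← ModuleCat.comp_apply, IsIso.inv_hom_id, ModuleCat.id_apply]⟩
  -- Step 2: the square `eW ≫ q_C = (hW)_* ≫ eX` and the commutation `q_B ≫ b = a ≫ q_C`
  have hsq : relativeSingularHomology.map R R (subsetIncl (((𝓡∂ (n + 1 + 1)).boundary c.W)ᶜ))
        (mapsTo_preimage Subtype.val (c.collarNhd κ 1)) (n + 1 + 1) ≫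
      relativeSingularHomology.map R R (boundaryCollapse (n + 1) c.W)
        (c.mapsTo_boundaryCollapse_collarNhd κ 1) (n + 1 + 1) =
      relativeSingularHomology.map R R
        (c.interiorHomeo : C(↥(((𝓡∂ (n + 1 + 1)).boundary c.W)ᶜ),
          ↥(({ClosedModel.infty}ᶜ : Set (ClosedModel (n + 1) c.W)))))
        (c.mapsTo_interiorHomeo κ 1) (n + 1 + 1) ≫
      relativeSingularHomology.map R R
        (subsetIncl ({ClosedModel.infty}ᶜ : Set (ClosedModel (n + 1) c.W)))
        (mapsTo_preimage Subtype.val (c.coneNhd κ 1)) (n + 1 + 1) := by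
    rw [← relativeSingularHomology.map_comp, ← relativeSingularHomology.map_comp]
    exact relativeSingularHomology.map_congr R R (c.subsetIncl_comp_interiorHomeo).symm _ _ _
  have hcomm : relativeSingularHomology.map R R (boundaryCollapse (n + 1) c.W)
        (mapsTo_boundaryCollapse (n + 1) c.W) (n + 1 + 1) ≫
      relativeSingularHomology.map R R (ContinuousMap.id (ClosedModel (n + 1) c.W))
        (mapsTo_id_of_subset hIN) (n + 1 + 1) =
      relativeSingularHomology.map R R (ContinuousMap.id c.W) (mapsTo_id_of_subset hBC) (n + 1 + 1) ≫
      relativeSingularHomology.map R R (boundaryCollapse (n + 1) c.W)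
        (c.mapsTo_boundaryCollapse_collarNhd κ 1) (n + 1 + 1) := by
    rw [← relativeSingularHomology.map_comp, ← relativeSingularHomology.map_comp]
    exact relativeSingularHomology.map_congr R R
      ((ContinuousMap.id_comp _).trans (ContinuousMap.comp_id _).symm) _ _ _
  -- Step 3: `u` and `v` in `H(Ŵ, N ∖ ∞)` have the same image in `H(Ŵ, N)`
  have huv : relativeSingularHomology.map R R (ContinuousMap.id _) (mapsTo_id_of_subset hPN) (n + 1 + 1)
        (relativeSingularHomology.ofAbsolute R R (ClosedModel (n + 1) c.W) (c.pCone κ) (n + 1 + 1)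
          (c.closedModelClass R R hn w)) =
      relativeSingularHomology.map R R (ContinuousMap.id _) (mapsTo_id_of_subset hPN) (n + 1 + 1)
        (relativeSingularHomology.map R R (subsetIncl ({ClosedModel.infty}ᶜ : Set (ClosedModel (n + 1) c.W)))
          (c.mapsTo_subsetIncl_compl_infty_pCone κ) (n + 1 + 1)
          (relativeSingularHomology.map R R
            (c.interiorHomeo : C(↥(((𝓡∂ (n + 1 + 1)).boundary c.W)ᶜ),
              ↥(({ClosedModel.infty}ᶜ : Set (ClosedModel (n + 1) c.W)))))
            (c.mapsTo_interiorHomeo κ 1) (n + 1 + 1) w')) := by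
    -- left-hand side: `b (q_B w) = q_C (a w)`
    have hl : relativeSingularHomology.map R R (ContinuousMap.id _) (mapsTo_id_of_subset hPN) (n + 1 + 1)
        (relativeSingularHomology.ofAbsolute R R (ClosedModel (n + 1) c.W) (c.pCone κ) (n + 1 + 1)
          (c.closedModelClass R R hn w)) =
        relativeSingularHomology.map R R (boundaryCollapse (n + 1) c.W)
          (c.mapsTo_boundaryCollapse_collarNhd κ 1) (n + 1 + 1)
          (relativeSingularHomology.map R R (ContinuousMap.id c.W) (mapsTo_id_of_subset hBC)
            (n + 1 + 1) w) := by
      rw [← ModuleCat.comp_apply, relativeSingularHomology.ofAbsolute_comp_map,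
        singularHomology.map_id, Category.id_comp]
      have e1 : relativeSingularHomology.ofAbsolute R R (ClosedModel (n + 1) c.W) (c.coneNhd κ 1)
          (n + 1 + 1) =
          relativeSingularHomology.ofAbsolute R R (ClosedModel (n + 1) c.W) {ClosedModel.infty}
            (n + 1 + 1) ≫
          relativeSingularHomology.map R R (ContinuousMap.id (ClosedModel (n + 1) c.W))
            (mapsTo_id_of_subset hIN) (n + 1 + 1) := by
        rw [relativeSingularHomology.ofAbsolute_comp_map, singularHomology.map_id, Category.id_comp]
      rw [e1, ModuleCat.comp_apply, ofAbsolute_closedModelClass, ← ModuleCat.comp_apply, hcomm,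
        ModuleCat.comp_apply]
    -- right-hand side: `eX w'' = q_C (eW w') = q_C (a w)`
    have hr : relativeSingularHomology.map R R (ContinuousMap.id _) (mapsTo_id_of_subset hPN) (n + 1 + 1)
        (relativeSingularHomology.map R R (subsetIncl ({ClosedModel.infty}ᶜ : Set (ClosedModel (n + 1) c.W)))
          (c.mapsTo_subsetIncl_compl_infty_pCone κ) (n + 1 + 1)
          (relativeSingularHomology.map R R
            (c.interiorHomeo : C(↥(((𝓡∂ (n + 1 + 1)).boundary c.W)ᶜ),
              ↥(({ClosedModel.infty}ᶜ : Set (ClosedModel (n + 1) c.W)))))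
            (c.mapsTo_interiorHomeo κ 1) (n + 1 + 1) w')) =
        relativeSingularHomology.map R R (boundaryCollapse (n + 1) c.W)
          (c.mapsTo_boundaryCollapse_collarNhd κ 1) (n + 1 + 1)
          (relativeSingularHomology.map R R (ContinuousMap.id c.W) (mapsTo_id_of_subset hBC)
            (n + 1 + 1) w) := by
      rw [← ModuleCat.comp_apply, ← relativeSingularHomology.map_comp]
      have e2 : relativeSingularHomology.map R R
          ((ContinuousMap.id (ClosedModel (n + 1) c.W)).comp
            (subsetIncl ({ClosedModel.infty}ᶜ : Set (ClosedModel (n + 1) c.W))))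
          ((mapsTo_id_of_subset hPN).comp (c.mapsTo_subsetIncl_compl_infty_pCone κ)) (n + 1 + 1) =
          relativeSingularHomology.map R R
            (subsetIncl ({ClosedModel.infty}ᶜ : Set (ClosedModel (n + 1) c.W)))
            (mapsTo_preimage Subtype.val (c.coneNhd κ 1)) (n + 1 + 1) :=
        relativeSingularHomology.map_congr R R (ContinuousMap.id_comp _) _ _ _
      rw [e2, ← ModuleCat.comp_apply, ← hsq, ModuleCat.comp_apply, hw']
    rw [hl, hr]
  -- Step 4: exactness of the triple gives `γ`
  obtain ⟨γ, hγ⟩ : ∃ γ : relativeSingularHomology R R ↥(c.coneNhd κ 1) (Subtype.val ⁻¹' c.pCone κ)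
      (n + 1 + 1),
      relativeSingularHomology.map R R (⟨Subtype.val, continuous_subtype_val⟩ : C(↥(c.coneNhd κ 1), _))
        (mapsTo_val_preimage (c.coneNhd κ 1) (c.pCone κ)) (n + 1 + 1) γ =
      relativeSingularHomology.ofAbsolute R R (ClosedModel (n + 1) c.W) (c.pCone κ) (n + 1 + 1)
          (c.closedModelClass R R hn w) -
      relativeSingularHomology.map R R (subsetIncl ({ClosedModel.infty}ᶜ : Set (ClosedModel (n + 1) c.W)))
          (c.mapsTo_subsetIncl_compl_infty_pCone κ) (n + 1 + 1)
          (relativeSingularHomology.map R R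
            (c.interiorHomeo : C(↥(((𝓡∂ (n + 1 + 1)).boundary c.W)ᶜ),
              ↥(({ClosedModel.infty}ᶜ : Set (ClosedModel (n + 1) c.W)))))
            (c.mapsTo_interiorHomeo κ 1) (n + 1 + 1) w') := by
    refine ((ShortComplex.moduleCat_exact_iff _).1
      (relativeSingularHomology.triple_exact₂ R R hPN (n + 1 + 1)) _ ?_)
    change relativeSingularHomology.map R R (ContinuousMap.id _) (mapsTo_id_of_subset hPN) (n + 1 + 1) _ = 0
    rw [map_sub, huv, sub_self]
  -- Step 5: `c_w|_∞` is the image of `γ` under an isomorphism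
  have hloc : singularHomology.toLocal R R ClosedModel.infty (n + 1 + 1) (c.closedModelClass R R hn w) =
      relativeSingularHomology.map R R (subsetIncl (c.coneNhd κ 1)) m_NPZ (n + 1 + 1) γ := by
    -- `toLocal ∞ = ofAbsolute P ≫ (id : (Ŵ, P) → (Ŵ, Ŵ ∖ ∞))_*`
    have e3 : singularHomology.toLocal R R (ClosedModel.infty : ClosedModel (n + 1) c.W) (n + 1 + 1) =
        relativeSingularHomology.ofAbsolute R R (ClosedModel (n + 1) c.W) (c.pCone κ) (n + 1 + 1) ≫
        relativeSingularHomology.map R R (ContinuousMap.id _) (mapsTo_id_of_subset hPZ) (n + 1 + 1) := by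
      rw [relativeSingularHomology.ofAbsolute_comp_map, singularHomology.map_id, Category.id_comp]
      rfl
    -- the `u`-term dies in `H(Ŵ | ∞)`: it factors through `H(Ŵ ∖ ∞, Ŵ ∖ ∞) = 0`
    have m' : MapsTo (subsetIncl ({ClosedModel.infty}ᶜ : Set (ClosedModel (n + 1) c.W)))
        (Subtype.val ⁻¹' c.coneNhd κ 1) ({ClosedModel.infty}ᶜ : Set (ClosedModel (n + 1) c.W)) :=
      fun z _ => z.2
    have e4 : relativeSingularHomology.map R R (ContinuousMap.id _) (mapsTo_id_of_subset hPZ) (n + 1 + 1)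
        (relativeSingularHomology.map R R (subsetIncl ({ClosedModel.infty}ᶜ : Set (ClosedModel (n + 1) c.W)))
          (c.mapsTo_subsetIncl_compl_infty_pCone κ) (n + 1 + 1)
          (relativeSingularHomology.map R R
            (c.interiorHomeo : C(↥(((𝓡∂ (n + 1 + 1)).boundary c.W)ᶜ),
              ↥(({ClosedModel.infty}ᶜ : Set (ClosedModel (n + 1) c.W)))))
            (c.mapsTo_interiorHomeo κ 1) (n + 1 + 1) w')) = 0 := by
      rw [← ModuleCat.comp_apply, ← relativeSingularHomology.map_comp,
        relativeSingularHomology.map_congr R R (f' := subsetIncl ({ClosedModel.infty}ᶜ :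
          Set (ClosedModel (n + 1) c.W))) (ContinuousMap.id_comp _)
          ((mapsTo_id_of_subset hPZ).comp (c.mapsTo_subsetIncl_compl_infty_pCone κ)) m' (n + 1 + 1),
        map_subsetIncl_eq_zero_of_forall_mem R R _ _ _ (fun z => z.2) m' (n + 1 + 1)]
      rfl
    -- the `γ`-term
    have e6 : relativeSingularHomology.map R R (ContinuousMap.id _) (mapsTo_id_of_subset hPZ) (n + 1 + 1)
        (relativeSingularHomology.map R R (⟨Subtype.val, continuous_subtype_val⟩ : C(↥(c.coneNhd κ 1), _))
          (mapsTo_val_preimage (c.coneNhd κ 1) (c.pCone κ)) (n + 1 + 1) γ) =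
        relativeSingularHomology.map R R (subsetIncl (c.coneNhd κ 1)) m_NPZ (n + 1 + 1) γ := by
      rw [← ModuleCat.comp_apply, ← relativeSingularHomology.map_comp,
        relativeSingularHomology.map_congr R R (f' := subsetIncl (c.coneNhd κ 1)) (ContinuousMap.id_comp _)
          ((mapsTo_id_of_subset hPZ).comp (mapsTo_val_preimage (c.coneNhd κ 1) (c.pCone κ))) m_NPZ
          (n + 1 + 1)]
    have e5 : relativeSingularHomology.ofAbsolute R R (ClosedModel (n + 1) c.W) (c.pCone κ) (n + 1 + 1)
          (c.closedModelClass R R hn w) =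
        relativeSingularHomology.map R R (⟨Subtype.val, continuous_subtype_val⟩ : C(↥(c.coneNhd κ 1), _))
          (mapsTo_val_preimage (c.coneNhd κ 1) (c.pCone κ)) (n + 1 + 1) γ +
        relativeSingularHomology.map R R (subsetIncl ({ClosedModel.infty}ᶜ : Set (ClosedModel (n + 1) c.W)))
          (c.mapsTo_subsetIncl_compl_infty_pCone κ) (n + 1 + 1)
          (relativeSingularHomology.map R R
            (c.interiorHomeo : C(↥(((𝓡∂ (n + 1 + 1)).boundary c.W)ᶜ),
              ↥(({ClosedModel.infty}ᶜ : Set (ClosedModel (n + 1) c.W)))))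
            (c.mapsTo_interiorHomeo κ 1) (n + 1 + 1) w') := by
      rw [hγ, sub_add_cancel]
    rw [e3, ModuleCat.comp_apply, e5, map_add, e4, add_zero, e6]
  -- the map `H(N, N ∖ ∞) → H(Ŵ | ∞)` is an isomorphism (set equality, then excision)
  haveI iP : IsIso (relativeSingularHomology.map R R (subsetIncl (c.coneNhd κ 1)) m_NPZ (n + 1 + 1)) := by
    have f3 : MapsTo (ContinuousMap.id ↥(c.coneNhd κ 1)) (Subtype.val ⁻¹' c.pCone κ)
        (Subtype.val ⁻¹' ({ClosedModel.infty}ᶜ : Set (ClosedModel (n + 1) c.W))) := by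
      rw [c.preimage_val_pCone κ]; exact mapsTo_id _
    have e6 : relativeSingularHomology.map R R (subsetIncl (c.coneNhd κ 1)) m_NPZ (n + 1 + 1) =
        relativeSingularHomology.map R R (ContinuousMap.id _) f3 (n + 1 + 1) ≫
        relativeSingularHomology.map R R (subsetIncl (c.coneNhd κ 1))
          (mapsTo_preimage Subtype.val ({ClosedModel.infty}ᶜ : Set (ClosedModel (n + 1) c.W))) (n + 1 + 1) := by
      rw [← relativeSingularHomology.map_comp]; rfl
    rw [e6]
    haveI := relativeSingularHomology.isIso_map_id_of_eq R R (c.preimage_val_pCone κ) f3 (n + 1 + 1)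
    haveI := c.isIso_map_subsetIncl_coneNhd_compl_infty κ R R (n + 1 + 1)
    infer_instance
  rw [hloc]
  refine (exists_linearEquiv_apply_eq_one_iff_of_isIso _ _).2 ?_
  -- Step 6: `γ` is a generator iff `∂γ` is
  haveI := c.isIso_δ_coneNhd_pCone κ R R (Nat.succ_ne_zero n)
  refine (exists_linearEquiv_apply_eq_one_iff_of_isIso
    (relativeSingularHomology.δ R R (↥(c.coneNhd κ 1)) (Subtype.val ⁻¹' c.pCone κ) (n + 1)) _).1 ?_
  -- Step 7: the `∂`-chase: `(r₁)_* ∂γ = - (r₂)_* ∂w''`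
  have hchase : singularHomology.map R R (subsetRestrict
        (⟨Subtype.val, continuous_subtype_val⟩ : C(↥(c.coneNhd κ 1), ClosedModel (n + 1) c.W))
        (mapsTo_val_preimage (c.coneNhd κ 1) (c.pCone κ))) (n + 1)
        (relativeSingularHomology.δ R R (↥(c.coneNhd κ 1)) (Subtype.val ⁻¹' c.pCone κ) (n + 1) γ) =
      -singularHomology.map R R (subsetRestrict
        (subsetIncl ({ClosedModel.infty}ᶜ : Set (ClosedModel (n + 1) c.W)))
        (c.mapsTo_subsetIncl_compl_infty_pCone κ)) (n + 1)
        (relativeSingularHomology.δ R R _ _ (n + 1)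
          (relativeSingularHomology.map R R
            (c.interiorHomeo : C(↥(((𝓡∂ (n + 1 + 1)).boundary c.W)ᶜ),
              ↥(({ClosedModel.infty}ᶜ : Set (ClosedModel (n + 1) c.W)))))
            (c.mapsTo_interiorHomeo κ 1) (n + 1 + 1) w')) := by
    rw [map_δ_apply, map_δ_apply, hγ, map_sub, δ_ofAbsolute_apply, zero_sub]
  -- Step 8: `∂w''` corresponds to `∂w'`, and `(r₃)_* ∂w' = (r₄)_* ∂w`
  have hchase2 : singularHomology.map R R (subsetRestrict (subsetIncl (((𝓡∂ (n + 1 + 1)).boundary c.W)ᶜ))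
        (mapsTo_preimage Subtype.val (c.collarNhd κ 1))) (n + 1)
        (relativeSingularHomology.δ R R _ _ (n + 1) w') =
      singularHomology.map R R (subsetRestrict (ContinuousMap.id c.W) (mapsTo_id_of_subset hBC)) (n + 1)
        (relativeSingularHomology.δ R R c.W ((𝓡∂ (n + 1 + 1)).boundary c.W) (n + 1) w) := by
    rw [map_δ_apply, map_δ_apply, hw']
  -- Step 9: generator bookkeeping
  haveI := c.isIso_map_restrict_boundary_collarNhd κ R R one_pos (n + 1)
  haveI := c.isIso_map_restrict_collarInterior κ R R (n + 1)
  haveI := c.isIso_map_restrict_interiorHomeo κ R R (n + 1)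
  haveI := c.isIso_map_restrict_incl_pCone κ R R (n + 1)
  haveI := c.isIso_map_restrict_val_pCone κ R R (n + 1)
  have g1 := (exists_linearEquiv_apply_eq_one_iff_of_isIso (singularHomology.map R R
    (subsetRestrict (ContinuousMap.id c.W) (mapsTo_id_of_subset hBC)) (n + 1)) _).2 hδ
  rw [← hchase2] at g1
  have g2 := (exists_linearEquiv_apply_eq_one_iff_of_isIso _ _).1 g1
  have g3 := (exists_linearEquiv_apply_eq_one_iff_of_isIso (singularHomology.map R R (subsetRestrict
    (c.interiorHomeo : C(↥(((𝓡∂ (n + 1 + 1)).boundary c.W)ᶜ),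
      ↥(({ClosedModel.infty}ᶜ : Set (ClosedModel (n + 1) c.W))))) (c.mapsTo_interiorHomeo κ 1)) (n + 1))
    _).2 g2
  rw [map_δ_apply] at g3
  have g4 := (exists_linearEquiv_apply_eq_one_iff_of_isIso (singularHomology.map R R (subsetRestrict
    (subsetIncl ({ClosedModel.infty}ᶜ : Set (ClosedModel (n + 1) c.W)))
    (c.mapsTo_subsetIncl_compl_infty_pCone κ)) (n + 1)) _).2 g3
  have g5 := exists_linearEquiv_apply_eq_one_neg g4
  rw [← hchase] at g5
  exact (exists_linearEquiv_apply_eq_one_iff_of_isIso _ _).1 g5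

end ConeAux

/-! ### The orientation of the closed model defined by a relative fundamental class -/

section Orientation

variable [IsManifold (𝓡 n) ∞ M] (κ : c.boundaryData.Collar)
  (R : Type v) [CommRing R]

omit [IsManifold (𝓡 n) ∞ M] in
/-- **`∂w` generates `Hₙ(∂W; R)`** for a relative fundamental class `w` of a compact `W` whose
boundary `∂W ≅ M` is connected and nonempty (`n ≠ 0`): `∂w` is the fundamental class of the
boundary orientation it induces (Spanier Cor. 6.3.10, `boundaryOrientation`), and on the closed
connected `n`-manifold `∂W` the map `Hₙ(∂W) → Hₙ(∂W | x)` is an isomorphism (Hatcher Thm. 3.26).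
[cite: Spanier1981, Ch. 6 Sec. 3 Cor. 10] -/
theorem isGenerator_δ_of_isRelFundamentalClass_of_ne [CompactSpace M] [ConnectedSpace M] [Nonempty M]
    (hn : n ≠ 0) {w : relativeSingularHomology R R c.W ((𝓡∂ (n + 1)).boundary c.W) (n + 1)}
    (hw : IsRelFundamentalClass R ((𝓡∂ (n + 1)).boundary c.W) w) :
    ∃ e : singularHomology R R ↥((𝓡∂ (n + 1)).boundary c.W) n ≃ₗ[R] R,
      e (relativeSingularHomology.δ R R c.W ((𝓡∂ (n + 1)).boundary c.W) n w) = 1 := by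
  letI := boundaryTopChartedSpace (n := n) (W := c.W)
  haveI : CompactSpace ↥((𝓡∂ (n + 1)).boundary c.W) :=
    isCompact_iff_compactSpace.1 isCompact_boundary
  haveI : ConnectedSpace ↥((𝓡∂ (n + 1)).boundary c.W) := by
    rw [← c.range_incl]
    exact isConnected_iff_connectedSpace.1 (isConnected_range c.continuous_incl)
  obtain ⟨x₀⟩ : Nonempty ↥((𝓡∂ (n + 1)).boundary c.W) := by
    rw [← c.range_incl]; exact ⟨⟨c.incl (Classical.arbitrary M), mem_range_self _⟩⟩
  haveI := isIso_toLocal_of_isFundamentalClass R (boundaryOrientation R hn hw)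
    (isFundamentalClass_δ R hn hw) x₀
  exact (exists_linearEquiv_apply_eq_one_iff_of_isIso (singularHomology.toLocal R R x₀ n) _).1
    ((boundaryOrientation R hn hw).isGenerator x₀)

include κ in
/-- **A relative fundamental class of `(W, ∂W)` orients the closed model `Ŵ = W ∪ cone(∂W)`**
(`∂W ≅ M` closed connected nonempty, `n ≥ 1`): the local images of `c_w = j⁻¹ q_* w` are
generators at every point — at interior points because `w` is a relative fundamental class
(`isGenerator_toLocal_closedModelClass_of_mem_interior`), at `∞` by the cone computation
(`isGenerator_toLocal_closedModelClass_infty_of`) — and they are tautologically locally consistent.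
Kervaire–Milnor 1963, footnote pp. 528–529: `W ∪ cone(bW)` is "a closed homology manifold".
[cite: KervaireMilnorAnnals1963, §7, footnote pp. 528–529] -/
def closedModelOrientation [Nonempty M] [CompactSpace M] [ConnectedSpace M] (hn : 1 ≤ n)
    {w : relativeSingularHomology R R c.W ((𝓡∂ (n + 1)).boundary c.W) (n + 1)}
    (hw : IsRelFundamentalClass R ((𝓡∂ (n + 1)).boundary c.W) w) :
    HomologicalOrientation R (ClosedModel n c.W) (n + 1) where
  localClass x := singularHomology.toLocal R R x (n + 1) (c.closedModelClass R R hn w)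
  isGenerator x := by
    induction x using OnePoint.rec with
    | infty =>
      exact c.isGenerator_toLocal_closedModelClass_infty_of κ R hn w
        (c.isGenerator_δ_of_isRelFundamentalClass_of_ne R (by omega) hw)
    | coe q =>
      have e : (q : OnePoint (ManifoldInterior n c.W)) = boundaryCollapse n c.W q.1 :=
        (boundaryCollapse_of_mem_interior q.2).symm
      rw [e]
      exact c.isGenerator_toLocal_closedModelClass_of_mem_interior R hn hw q.2
  locallyConsistent _ := ⟨univ, Filter.univ_mem, singularHomology.toLocalOfSet R R _ univ (n + 1)
      (c.closedModelClass R R hn w), fun _ hy => singularHomology.restrictToPoint_toLocalOfSet R R hy _ _⟩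

/-- The local classes of `closedModelOrientation` are the `c_w|ₓ`. [folklore] -/
@[simp] theorem closedModelOrientation_localClass [Nonempty M] [CompactSpace M] [ConnectedSpace M]
    (hn : 1 ≤ n) {w : relativeSingularHomology R R c.W ((𝓡∂ (n + 1)).boundary c.W) (n + 1)}
    (hw : IsRelFundamentalClass R ((𝓡∂ (n + 1)).boundary c.W) w) (x : ClosedModel n c.W) :
    (c.closedModelOrientation κ R hn hw).localClass x =
      singularHomology.toLocal R R x (n + 1) (c.closedModelClass R R hn w) := rfl

/-- **`c_w` is a fundamental class of the orientation it defines.** [cite: HatcherAT2002, §3.3 Thm. 3.26 (fundamental class)] -/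
theorem isFundamentalClass_closedModelClass [Nonempty M] [CompactSpace M] [ConnectedSpace M]
    (hn : 1 ≤ n) {w : relativeSingularHomology R R c.W ((𝓡∂ (n + 1)).boundary c.W) (n + 1)}
    (hw : IsRelFundamentalClass R ((𝓡∂ (n + 1)).boundary c.W) w) :
    IsFundamentalClass (c.closedModelOrientation κ R hn hw) (c.closedModelClass R R hn w) :=
  fun _ => rfl

/-- **`[Ŵ] = c_w`**: the (chosen) fundamental class of `closedModelOrientation` is `c_w`
(uniqueness of fundamental classes on the closed model, `ClosedModel.isFundamentalClass_unique`).
[cite: HatcherAT2002, Lemma 3.27(a)] -/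
theorem fundamentalClass_closedModelOrientation [Nonempty M] [CompactSpace M] [ConnectedSpace M]
    (hn : 1 ≤ n) {w : relativeSingularHomology R R c.W ((𝓡∂ (n + 1)).boundary c.W) (n + 1)}
    (hw : IsRelFundamentalClass R ((𝓡∂ (n + 1)).boundary c.W) w) :
    (c.closedModelOrientation κ R hn hw).fundamentalClass = c.closedModelClass R R hn w :=
  ClosedModel.isFundamentalClass_unique
    (HomologicalOrientation.isFundamentalClass_fundamentalClass_of_exists
      ⟨_, c.isFundamentalClass_closedModelClass κ R hn hw⟩)
    (c.isFundamentalClass_closedModelClass κ R hn hw)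

end Orientation

/-! ### From Kervaire–Milnor's oriented-boundary data to relative fundamental classes -/

section OrientedBy

variable [IsManifold (𝓡 n) ∞ M] [T2Space M] [CompactSpace M] [Nonempty M]

omit [IsManifold (𝓡 n) ∞ M] [T2Space M] [CompactSpace M] [Nonempty M] in
/-- The boundary identification `M → ∂W ⊆ W`, corestricted, is the homeomorphism
`NullCobordism.bdryHomeomorph`. [folklore] -/
theorem boundaryCorestrict_inclMap_eq :
    boundaryCorestrict n c.inclMap c.incl_mem_boundary = (c.bdryHomeomorph : C(M, _)) := by
  ext x; rfl

omit [IsManifold (𝓡 n) ∞ M] [T2Space M] [CompactSpace M] [Nonempty M] in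
/-- The boundary identification `M → ∂W` of a null-cobordism is a homeomorphism; in particular it
is injective on homology. [folklore] -/
theorem isIso_map_boundaryCorestrict_inclMap (k : ℕ) :
    IsIso (singularHomology.map ℤ ℤ (boundaryCorestrict n c.inclMap c.incl_mem_boundary) k) := by
  rw [c.boundaryCorestrict_inclMap_eq]
  exact (singularHomology.mapIso ℤ ℤ c.bdryHomeomorph k).isIso_hom

/-- **Oriented-boundary data make `[Ŵ]_{μ'}` a genuine fundamental class** (`n ≥ 1`): if
`(M, μ) = bW` as oriented manifolds in the sense of `NullCobordism.IsOrientedBy` (a class `w` with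
`∂w = incl_* [M]_μ` and `q_* w = j_* [Ŵ]_{μ'}`), then a fundamental class for `μ'` exists — else
`[Ŵ]_{μ'}` would be the junk value `0`, forcing `w = 0` (`q_*` is injective, Hatcher Prop. 2.22)
and `[M]_μ = 0`, which is absurd on the closed manifold `M` (Hatcher Thm. 3.26). [cite: HatcherAT2002, Thm. 3.26 and Prop. 2.22] -/
theorem IsOrientedBy.isFundamentalClass_fundamentalClass (hn : 1 ≤ n)
    {μ : HomologicalOrientation ℤ M n} {μ' : HomologicalOrientation ℤ (ClosedModel n c.W) (n + 1)}
    (hob : c.IsOrientedBy μ μ') : IsFundamentalClass μ' μ'.fundamentalClass := by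
  obtain ⟨m, rfl⟩ : ∃ m, n = m + 1 := ⟨n - 1, by omega⟩
  refine HomologicalOrientation.isFundamentalClass_fundamentalClass_of_exists ?_
  by_contra hne
  obtain ⟨w, hw₁, hw₂⟩ := hob
  rw [HomologicalOrientation.fundamentalClass_of_not_exists hne, map_zero] at hw₂
  haveI := c.isIso_map_boundaryCollapse_succ ℤ ℤ (m + 1 + 1)
  have hw0 : w = 0 :=
    (ModuleCat.mono_iff_injective _).1 inferInstance (by rw [hw₂, map_zero])
  rw [hw0, map_zero] at hw₁
  haveI := c.isIso_map_boundaryCorestrict_inclMap (m + 1)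
  have hM0 : μ.fundamentalClass = 0 :=
    (ModuleCat.mono_iff_injective _).1 inferInstance (by rw [← hw₁, map_zero])
  -- but `[M]_μ` restricts to generators
  obtain ⟨x⟩ := (inferInstance : Nonempty M)
  have hgen : IsFundamentalClass μ μ.fundamentalClass :=
    HomologicalOrientation.isFundamentalClass_fundamentalClass_holds (R := ℤ) (X := M) (m + 1) μ
  replace hgen := hgen x
  rw [hM0, map_zero] at hgen
  obtain ⟨e, he⟩ := μ.isGenerator x
  rw [← hgen, map_zero] at he
  exact zero_ne_one he

/-- **Oriented-boundary data, unpacked** (`n ≥ 1`, `M` closed connected nonempty): if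
`(M, μ) = bW` as oriented manifolds with orientation `μ'` of the closed model
(`NullCobordism.IsOrientedBy`), then the relative class `w` is a **relative fundamental class** of
`(W, ∂W)` in Spanier's sense, `[Ŵ]_{μ'}` is the class `c_w = j⁻¹ q_* w`, and `∂w = incl_* [M]_μ`.
This identifies Kervaire–Milnor's "`Σ = bM`" (1963, §7) with Hatcher's `∂[W, ∂W] = [∂W]` for a
relative fundamental class (2002, p. 253). [cite: HatcherAT2002, §3.3 p. 253 (relative fundamental class)] -/
theorem IsOrientedBy.exists_isRelFundamentalClass (hn : 1 ≤ n)
    {μ : HomologicalOrientation ℤ M n} {μ' : HomologicalOrientation ℤ (ClosedModel n c.W) (n + 1)}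
    (hob : c.IsOrientedBy μ μ') :
    ∃ w : relativeSingularHomology ℤ ℤ c.W ((𝓡∂ (n + 1)).boundary c.W) (n + 1),
      IsRelFundamentalClass ℤ ((𝓡∂ (n + 1)).boundary c.W) w ∧
      μ'.fundamentalClass = c.closedModelClass ℤ ℤ hn w ∧
      relativeSingularHomology.δ ℤ ℤ c.W ((𝓡∂ (n + 1)).boundary c.W) n w =
        singularHomology.map ℤ ℤ (boundaryCorestrict n c.inclMap c.incl_mem_boundary) n
          μ.fundamentalClass := by
  have hfc := hob.isFundamentalClass_fundamentalClass c hn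
  obtain ⟨w, hw₁, hw₂⟩ := hob
  have hcw : μ'.fundamentalClass = c.closedModelClass ℤ ℤ hn w :=
    c.eq_closedModelClass_of_ofAbsolute_eq ℤ ℤ hn w hw₂.symm
  refine ⟨w, fun y => ?_, hcw, hw₁⟩
  have hy : (y : c.W) ∈ (𝓡∂ (n + 1)).interior c.W := by
    rw [← ModelWithCorners.compl_boundary]; exact y.2
  haveI := c.isIso_localMap_boundaryCollapse ℤ ℤ hy (n + 1)
  refine (exists_linearEquiv_apply_eq_one_iff_of_isIso (relativeSingularHomology.map ℤ ℤ
    (boundaryCollapse n c.W) (c.mapsTo_boundaryCollapse_compl_singleton hy) (n + 1)) _).1 ?_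
  have e := c.toLocal_closedModelClass_of_mem_interior ℤ ℤ hn w hy
  rw [← hcw] at e
  rw [← e, hfc (boundaryCollapse n c.W y)]
  exact μ'.isGenerator _

omit [T2Space M] in
/-- **Conversely, a relative fundamental class yields oriented-boundary data**: for a relative
fundamental class `w` of `(W, ∂W)` over `ℤ` (`n ≥ 1`, `∂W ≅ M` closed connected nonempty), the
orientation `closedModelOrientation w` of `Ŵ` and the boundary orientation of `∂w` transported to
`M` satisfy Kervaire–Milnor's `(M, μ) = bW` (`NullCobordism.IsOrientedBy`), with witness `w`:
`∂w = incl_* [M]_μ` (Spanier Cor. 6.3.10: `∂w = [∂W]`) and `q_* w = j_* c_w = j_* [Ŵ]`.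
[cite: KervaireMilnorAnnals1963, §2 ("-M") and §7 ("Σ = bM")] -/
theorem isOrientedBy_closedModelOrientation [ConnectedSpace M] (κ : c.boundaryData.Collar) (hn : 1 ≤ n)
    {w : relativeSingularHomology ℤ ℤ c.W ((𝓡∂ (n + 1)).boundary c.W) (n + 1)}
    (hw : IsRelFundamentalClass ℤ ((𝓡∂ (n + 1)).boundary c.W) w) :
    c.IsOrientedBy ((boundaryOrientation ℤ (by omega) hw).comap c.bdryHomeomorph)
      (c.closedModelOrientation κ ℤ hn hw) := by
  refine ⟨w, ?_, ?_⟩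
  · letI := boundaryTopChartedSpace (n := n) (W := c.W)
    haveI : CompactSpace ↥((𝓡∂ (n + 1)).boundary c.W) :=
      isCompact_iff_compactSpace.1 isCompact_boundary
    rw [HomologicalOrientation.fundamentalClass_comap_holds (R := ℤ)
        (X := ↥((𝓡∂ (n + 1)).boundary c.W)) (Y := M) n _ c.bdryHomeomorph,
      boundaryOrientation_fundamentalClass_eq, c.boundaryCorestrict_inclMap_eq,
      ← singularHomology.mapIso_hom, ← ModuleCat.comp_apply, Iso.inv_hom_id, ModuleCat.id_apply]
  · rw [fundamentalClass_closedModelOrientation, ofAbsolute_closedModelClass]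

end OrientedBy

end NullCobordism

end Literature.Topology.FourManifolds
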